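import Mathlib
import Summits.PneNP.PneNP.Theorems.CnfIdealGenLengthRankDefectRepresentationsOneSidedPair
import Summits.PneNP.PneNP.Theorems.CnfIdealGenLengthRankDefectRepresentationsSharpLocalCut
import Summits.PneNP.PneNP.Theorems.CnfIdealGenLengthRankDefectRepresentationsSharpAverageCut

/-!
# Crux `RankDefectRepresentations` (stmt-PneNP-18923), line `rank-dehn-ladder`: the SHARP one-family max-cut decomposition, unconditionally
# (lead g16; memo `Cruxes/RankDefectRepresentations/Lines/rank-dehn-ladder-g16.md` §1)

Assembly of the three landed stubs W18 (`…OneSidedPair`, p715251), W19 (`…SharpLocalCut`), W20 (`…SharpAverageCut`, p715138):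
* `sharpLocalCut` — for EVERY colour set `B`, a colour-labelled matrix `R` is within rank `2μ(B) + ½ Σ_i (μ(B△{i}) − μ(B))` (stated doubled) of a
  colour-block-diagonal matrix, `μ(B) = rank R|_{B×Bᶜ} + rank R|_{Bᶜ×B}`;
* `maxCut_two` — **Theorem 2 with the sharp constant 2**: at a (global) maximiser `B` of `μ`, `rank (R − R′) ≤ 2 μ(B)` (g7's p642852 had 4);
* `sharpAverageCut` — **`mc(R) ≤ 2 · E_B μ(B)`**: `2^{#Q} · rank (R − R′) ≤ 2 Σ_B μ(B)`.  Sharp: a single off-diagonal block.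
HONEST FRAMING: negative-lane tools; the item (RDR) stays open; P ≠ NP is not moved; F-N2 is a FRONTIER formal rung.
-/

set_option linter.dupNamespace false -- `Summit.PneNP.PneNP.…`: summit = sub-problem name (D-0017)

namespace Summit.PneNP.PneNP.Theorems.CnfIdealGenLengthRankDefectRepresentationsSharpOneFamily

open Matrix Finset

variable {K : Type} [Field K] {ι ι' Q : Type} [Fintype ι] [Fintype ι'] [DecidableEq ι] [DecidableEq ι'] [Fintype Q] [DecidableEq Q]

/-- **Sharp local cut inequality** (unconditional): for every `B`, `R` is within rank `2μ(B) + ½ Σ_i (μ(B△{i}) − μ(B))` of a colour-block-diagonal matrix. -/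
theorem sharpLocalCut (row : ι → Q) (col : ι' → Q) (R : Matrix ι ι' K) (B : Finset Q) :
    ∃ R' : Matrix ι ι' K, (∀ x y, row x ≠ col y → R' x y = 0) ∧
      2 * ((R - R').rank : ℤ) ≤
        4 * (((Matrix.of fun x y => if row x ∈ B ∧ col y ∉ B then R x y else 0).rank : ℤ) +
            ((Matrix.of fun x y => if row x ∉ B ∧ col y ∈ B then R x y else 0).rank : ℤ)) +
        ∑ i : Q, ((((Matrix.of fun x y => if row x ∈ symmDiff B {i} ∧ col y ∉ symmDiff B {i} then R x y else 0).rank : ℤ) +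
            ((Matrix.of fun x y => if row x ∉ symmDiff B {i} ∧ col y ∈ symmDiff B {i} then R x y else 0).rank : ℤ)) -
          (((Matrix.of fun x y => if row x ∈ B ∧ col y ∉ B then R x y else 0).rank : ℤ) +
            ((Matrix.of fun x y => if row x ∉ B ∧ col y ∈ B then R x y else 0).rank : ℤ))) :=
  Summit.PneNP.PneNP.Theorems.CnfIdealGenLengthRankDefectRepresentationsSharpLocalCut.stub_sharpLocalCut
    Summit.PneNP.PneNP.Theorems.CnfIdealGenLengthRankDefectRepresentationsOneSidedPair.stub_oneSidedPair K ι ι' Q row col R B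

/-- **Theorem 2 with the sharp constant 2**: if `B` maximises the bipartition cut `μ`, then `R` is within rank `2 μ(B)` of a colour-block-diagonal matrix. -/
theorem maxCut_two (row : ι → Q) (col : ι' → Q) (R : Matrix ι ι' K) (B : Finset Q)
    (hmax : ∀ B' : Finset Q,
      (Matrix.of fun x y => if row x ∈ B' ∧ col y ∉ B' then R x y else 0).rank +
        (Matrix.of fun x y => if row x ∉ B' ∧ col y ∈ B' then R x y else 0).rank ≤
      (Matrix.of fun x y => if row x ∈ B ∧ col y ∉ B then R x y else 0).rank +
        (Matrix.of fun x y => if row x ∉ B ∧ col y ∈ B then R x y else 0).rank) :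
    ∃ R' : Matrix ι ι' K, (∀ x y, row x ≠ col y → R' x y = 0) ∧
      (R - R').rank ≤ 2 * ((Matrix.of fun x y => if row x ∈ B ∧ col y ∉ B then R x y else 0).rank +
        (Matrix.of fun x y => if row x ∉ B ∧ col y ∈ B then R x y else 0).rank) := by
  obtain ⟨R', hR', h⟩ := sharpLocalCut row col R B
  refine ⟨R', hR', ?_⟩
  have hsum : ∑ i : Q, ((((Matrix.of fun x y => if row x ∈ symmDiff B {i} ∧ col y ∉ symmDiff B {i} then R x y else 0).rank : ℤ) +
      ((Matrix.of fun x y => if row x ∉ symmDiff B {i} ∧ col y ∈ symmDiff B {i} then R x y else 0).rank : ℤ)) -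
      (((Matrix.of fun x y => if row x ∈ B ∧ col y ∉ B then R x y else 0).rank : ℤ) +
        ((Matrix.of fun x y => if row x ∉ B ∧ col y ∈ B then R x y else 0).rank : ℤ))) ≤ 0 := by
    refine Finset.sum_nonpos fun i _ => ?_
    have := hmax (symmDiff B {i})
    have : (((Matrix.of fun x y => if row x ∈ symmDiff B {i} ∧ col y ∉ symmDiff B {i} then R x y else 0).rank : ℤ) +
        ((Matrix.of fun x y => if row x ∉ symmDiff B {i} ∧ col y ∈ symmDiff B {i} then R x y else 0).rank : ℤ)) ≤
        (((Matrix.of fun x y => if row x ∈ B ∧ col y ∉ B then R x y else 0).rank : ℤ) +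
          ((Matrix.of fun x y => if row x ∉ B ∧ col y ∈ B then R x y else 0).rank : ℤ)) := by exact_mod_cast this
    linarith
  have : 2 * ((R - R').rank : ℤ) ≤ 4 * (((Matrix.of fun x y => if row x ∈ B ∧ col y ∉ B then R x y else 0).rank : ℤ) +
      ((Matrix.of fun x y => if row x ∉ B ∧ col y ∈ B then R x y else 0).rank : ℤ)) := by linarith
  have : ((R - R').rank : ℤ) ≤ 2 * (((Matrix.of fun x y => if row x ∈ B ∧ col y ∉ B then R x y else 0).rank : ℤ) +
      ((Matrix.of fun x y => if row x ∉ B ∧ col y ∈ B then R x y else 0).rank : ℤ)) := by linarith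
  exact_mod_cast this

/-- **The sharp one-family average-cut decomposition** (unconditional): `2^{#Q} · rank (R − R′) ≤ 2 · Σ_B μ(B)`, i.e. `mc(R) ≤ 2 · E_B μ(B)`. -/
theorem sharpAverageCut (row : ι → Q) (col : ι' → Q) (R : Matrix ι ι' K) :
    ∃ R' : Matrix ι ι' K, (∀ x y, row x ≠ col y → R' x y = 0) ∧
      2 ^ Fintype.card Q * (R - R').rank ≤
        2 * ∑ B : Finset Q, ((Matrix.of fun x y => if row x ∈ B ∧ col y ∉ B then R x y else 0).rank +
            (Matrix.of fun x y => if row x ∉ B ∧ col y ∈ B then R x y else 0).rank) :=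
  Summit.PneNP.PneNP.Theorems.CnfIdealGenLengthRankDefectRepresentationsSharpAverageCut.stub_sharpAverageCut
    (fun K _ ι ι' Q _ _ _ _ _ _ row col R B =>
      Summit.PneNP.PneNP.Theorems.CnfIdealGenLengthRankDefectRepresentationsSharpLocalCut.stub_sharpLocalCut
        Summit.PneNP.PneNP.Theorems.CnfIdealGenLengthRankDefectRepresentationsOneSidedPair.stub_oneSidedPair K ι ι' Q row col R B)
    K ι ι' Q row col R

end Summit.PneNP.PneNP.Theorems.CnfIdealGenLengthRankDefectRepresentationsSharpOneFamily
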